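import Mathlib.Analysis.Calculus.LagrangeMultipliers
import Mathlib.Analysis.Calculus.ContDiff.RCLike
import Literature.Geometry.Lorentzian.Stationary
import HarnessLib

/-!
# Crux `HawkingExtensionIsKerr` (stmt-FinalStateConjecture-17840), line `SketchIdeator2` —
# collar zeroth law, step C: tangential derivatives along a regular level set

Helper file of the line lead (c3), programme "collar zeroth law" (discharge of the zeroth-law
debt `VacuumHorizonZerothLaw` in the collar setting of the crux).  Step C is the calculus lemma
used to differentiate, along the horizon, identities that hold on the horizon: near a point `q`
where the horizon is the regular level set `{f = 0}` of `f = g(K, K)`, a `C¹` function `F`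
constant on `{f = f q}` near `q` has `dF_q = μ df_q` (`exists_mvfderiv_eq_smul_of_levelSet`), in
particular `dF_q` kills `ker df_q` (`mvfderiv_apply_eq_zero_of_levelSet`).  Proof: read `f`, `F`
in the chart at `q` and apply the Lagrange multiplier theorem (Mathlib
`IsLocalExtrOn.exists_multipliers_of_hasStrictFDerivAt_1d`) to the trivial extremum of `F` on
the level set.  Reference: any calculus text; Mathlib `Analysis.Calculus.LagrangeMultipliers`.
-/

noncomputable section

set_option linter.dupNamespace false

namespace Summit.FinalStateConjecture.FinalStateConjecture.Theorems.HawkingExtensionIsKerr.SketchIdeator2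

open Set Function Filter Literature.Geometry.Lorentzian
open scoped Manifold ContDiff Topology

section Tangential

variable {E : Type*} [NormedAddCommGroup E] [NormedSpace ℝ E]
  {H : Type*} [TopologicalSpace H] {I : ModelWithCorners ℝ E H} [I.Boundaryless]
  {M : Type*} [TopologicalSpace M] [ChartedSpace H M]

/-- A `C¹` real function read in the extended chart at `q` is `C¹` at the base point
(boundaryless model). [folklore] -/
theorem contDiffAt_comp_extChartAt_symm_real {f : M → ℝ} {q : M}
    (hf : ContMDiffAt I 𝓘(ℝ, ℝ) 1 f q) :
    ContDiffAt ℝ 1 (f ∘ (extChartAt I q).symm) (extChartAt I q q) := by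
  have h := (contMDiffAt_iff.1 hf).2
  simpa only [extChartAt_model_space_eq_id, PartialEquiv.refl_coe, id_comp,
    ModelWithCorners.Boundaryless.range_eq_univ (I := I), contDiffWithinAt_univ] using h

/-- `mvfderiv` at the centre of the chart is the Fréchet derivative of the chart expression
(boundaryless model; cf. `mvfderiv_eq_fderiv_extChartAt` of `LieDerivMetricChart.lean`).
[folklore] -/
theorem mvfderiv_eq_fderiv_extChartAt_real {f : M → ℝ} {q : M}
    (hf : MDifferentiableAt I 𝓘(ℝ, ℝ) f q) (v : TangentSpace I q) :
    mvfderiv I f q v = fderiv ℝ (f ∘ (extChartAt I q).symm) (extChartAt I q q) v := by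
  have hw : writtenInExtChartAt I 𝓘(ℝ, ℝ) q f = f ∘ (extChartAt I q).symm := by
    ext z
    simp [writtenInExtChartAt]
  simp only [mvfderiv, ContinuousLinearMap.coe_comp, comp_apply]
  rw [hf.mfderiv, hw, ModelWithCorners.Boundaryless.range_eq_univ, fderivWithin_univ]
  rfl

/-- **Tangential derivatives along a regular level set (Lagrange multiplier form).**  If `f`, `F`
are `C¹` at `q`, `F` is constant on the level set `{f = f q}` near `q`, and `df_q ≠ 0`, then
`dF_q = μ df_q` for some real `μ`. -/
theorem exists_mvfderiv_eq_smul_of_levelSet [CompleteSpace E] {f F : M → ℝ} {q : M}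
    (hf : ContMDiffAt I 𝓘(ℝ, ℝ) 1 f q) (hF : ContMDiffAt I 𝓘(ℝ, ℝ) 1 F q)
    (hzero : ∀ᶠ x in 𝓝 q, f x = f q → F x = F q) (hdf : mvfderiv I f q ≠ 0) :
    ∃ μ : ℝ, mvfderiv I F q = μ • mvfderiv I f q := by
  set φ := extChartAt I q with hφ
  set e₀ : E := φ q with he₀
  have hq : φ.symm e₀ = q := extChartAt_to_inv q
  -- chart expressions and their strict derivatives
  have hfc : ContDiffAt ℝ 1 (f ∘ φ.symm) e₀ := contDiffAt_comp_extChartAt_symm_real hf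
  have hFc : ContDiffAt ℝ 1 (F ∘ φ.symm) e₀ := contDiffAt_comp_extChartAt_symm_real hF
  have hfs := hfc.hasStrictFDerivAt one_ne_zero
  have hFs := hFc.hasStrictFDerivAt one_ne_zero
  -- `F ∘ φ⁻¹` has a (trivial) local extremum on the level set of `f ∘ φ⁻¹` at `e₀`
  have hcont : ContinuousAt φ.symm e₀ := continuousAt_extChartAt_symm q
  have hzero' : ∀ᶠ x in 𝓝 e₀, (f ∘ φ.symm) x = (f ∘ φ.symm) e₀ →
      (F ∘ φ.symm) x = (F ∘ φ.symm) e₀ := by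
    have h := hcont.eventually (by rw [hq]; exact hzero)
    filter_upwards [h] with x hx
    simp only [comp_apply, hq] at hx ⊢
    exact hx
  have hextr : IsLocalExtrOn (F ∘ φ.symm) {x | (f ∘ φ.symm) x = (f ∘ φ.symm) e₀} e₀ := by
    refine Or.inl ?_
    refine (eventually_nhdsWithin_iff.mpr ?_)
    filter_upwards [hzero'] with x hx hxmem
    exact (hx hxmem).symm.le
  obtain ⟨a, b, hab, hlin⟩ := hextr.exists_multipliers_of_hasStrictFDerivAt_1d hfs hFs
  -- identify the manifold derivatives with the chart derivatives
  have hf' : ∀ v, mvfderiv I f q v = fderiv ℝ (f ∘ φ.symm) e₀ v := fun v ↦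
    mvfderiv_eq_fderiv_extChartAt_real (hf.mdifferentiableAt one_ne_zero) v
  have hF' : ∀ v, mvfderiv I F q v = fderiv ℝ (F ∘ φ.symm) e₀ v := fun v ↦
    mvfderiv_eq_fderiv_extChartAt_real (hF.mdifferentiableAt one_ne_zero) v
  -- `b ≠ 0` since `df_q ≠ 0`
  have hb : b ≠ 0 := by
    rintro rfl
    have ha : a ≠ 0 := by
      intro ha; exact hab (by rw [ha]; rfl)
    apply hdf
    ext v
    have h := congrArg (fun L : E →L[ℝ] ℝ ↦ L v) hlin
    simp only [zero_smul, add_zero, FunLike.coe_smul, Pi.smul_apply, smul_eq_mul,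
      zero_apply, mul_eq_zero] at h
    rw [hf' v]
    simpa using h.resolve_left ha
  refine ⟨-(a / b), ?_⟩
  ext v
  have h := congrArg (fun L : E →L[ℝ] ℝ ↦ L v) hlin
  simp only [add_apply, FunLike.coe_smul, Pi.smul_apply, smul_eq_mul, zero_apply] at h
  rw [smul_apply, hF' v, hf' v, smul_eq_mul]
  field_simp
  linarith

/-- **Tangential derivatives kill `ker df`**: under the hypotheses of
`exists_mvfderiv_eq_smul_of_levelSet`, `dF_q(X) = 0` whenever `df_q(X) = 0`. -/
theorem mvfderiv_apply_eq_zero_of_levelSet [CompleteSpace E] {f F : M → ℝ} {q : M}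
    (hf : ContMDiffAt I 𝓘(ℝ, ℝ) 1 f q) (hF : ContMDiffAt I 𝓘(ℝ, ℝ) 1 F q)
    (hzero : ∀ᶠ x in 𝓝 q, f x = f q → F x = F q) (hdf : mvfderiv I f q ≠ 0)
    {X : TangentSpace I q} (hX : mvfderiv I f q X = 0) : mvfderiv I F q X = 0 := by
  obtain ⟨μ, hμ⟩ := exists_mvfderiv_eq_smul_of_levelSet hf hF hzero hdf
  rw [hμ, smul_apply, hX, smul_zero]

end Tangential


/-- **Registered sub-goal form of step C** (closed statement over `E4`-charted carriers, crux
stmt-FinalStateConjecture-17840): tangential derivatives along a regular level set. -/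
theorem stub_levelSet_tangentialDerivative : ∀ (M : Type) [TopologicalSpace M] [ChartedSpace E4 M] (f F : M → ℝ) (q : M), ContMDiffAt (𝓡 4) 𝓘(ℝ, ℝ) 1 f q → ContMDiffAt (𝓡 4) 𝓘(ℝ, ℝ) 1 F q → (∀ᶠ x in 𝓝 q, f x = f q → F x = F q) → mvfderiv (𝓡 4) f q ≠ 0 → ∃ μ : ℝ, mvfderiv (𝓡 4) F q = μ • mvfderiv (𝓡 4) f q :=
  fun _ _ _ _ _ _ hf hF hzero hdf ↦ exists_mvfderiv_eq_smul_of_levelSet hf hF hzero hdf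

end Summit.FinalStateConjecture.FinalStateConjecture.Theorems.HawkingExtensionIsKerr.SketchIdeator2

end
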